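import Literature.Analysis.FluidPDE.GaussianVortexDriftResolvent
import Literature.Analysis.FluidPDE.GaussianVortexFormDomainRellich
import Mathlib.Analysis.InnerProductSpace.Adjoint
import HarnessLib

/-!
# The convex set of the Schauder argument for asymmetric Burgers vortices

Analysis/FluidPDE definitions file, part of the existence proof behind the named fact
`GallayMaekawa2016_thm41` (Gallay–Maekawa 2016, Thm. 4.1, Leray–Schauder part [M2]). In the
ground-state variables `w = ρ_λ u`, `U = (u, G) ∈ H = H¹(μ_λ)`, the fixed-point map is
`u ↦ (driftSolve (v := K_{2D} ∗ (ρ_λ u)) κ u).fst` (`GaussianVortexDriftResolvent`), and Schauder's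
theorem is applied on the closed convex set `K ⊆ L²(μ_λ)` of first components of pairs `U ∈ H`
with `u ≥ 0`, `∫ u dμ_λ = α`, and bounds on the flat norms `‖w‖₂ = ‖S u‖`, `‖∇w‖₂ = ‖T U‖`, on
`‖u‖` and on `‖U‖_H`. This file provides the two bounded operators

* `sqrtWeightMulL : L²(μ_λ) →L L²(μ_λ)`, `u ↦ e^{−q_λ/2} u` (`‖S u‖² = ⟪u, (ρU)₁⟫ = ‖w‖₂²`);
* `flatGradL : L²(μ_λ) × L²(μ_λ;ℝ²) →L L²(μ_λ;ℝ²)`, `(u, G) ↦ e^{−q_λ/2}(G − u b_λ)`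
  (`‖T U‖² = ∫ ρ‖G − u b‖² dμ_λ = ‖∇w‖₂²`);

weak sequential limits in the real Hilbert space `L² × L²` along ultrafilters
(`exists_weak_limit_ultrafilter_real`), and the **closedness** in `L²(μ_λ)` of the sets
`{u | ∃ U ∈ H, U.fst = u, P(u), ‖T U‖ ≤ R₁, ‖U‖ ≤ R_H}` for norm-closed `P`
(`isClosed_fst_image_constraints`), by weak compactness of balls of `H` and weak lower
semicontinuity of `‖T ·‖` and `‖·‖`.

## References

* Th. Gallay, Y. Maekawa, *Existence and stability of viscous vortices*, arXiv:1610.08384, §4.1,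
  Thm. 4.1. [GallayMaekawa2016]
-/

open MeasureTheory Filter Set WithLp Metric
open scoped Real RealInnerProductSpace Topology InnerProductSpace ContDiff

noncomputable section

namespace Literature.Analysis.FluidPDE

open Literature.Analysis.UnboundedOperators

/-! ### Weak limits along ultrafilters in a real Hilbert space -/

section WeakLimit

variable {E : Type*} [NormedAddCommGroup E] [InnerProductSpace ℝ E] [CompleteSpace E]

/-- Bounded real nets converge along ultrafilters. [folklore] -/
theorem exists_tendsto_ultrafilter_of_abs_le {ι : Type*} (𝔘 : Ultrafilter ι) {c : ι → ℝ} {R : ℝ}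
    (hc : ∀ i, |c i| ≤ R) : ∃ x : ℝ, |x| ≤ R ∧ Tendsto c (𝔘 : Filter ι) (𝓝 x) := by
  have hle : (𝔘 : Filter ι).map c ≤ 𝓟 (closedBall (0 : ℝ) R) := by
    rw [le_principal_iff, mem_map]
    exact Eventually.of_forall fun i => mem_closedBall_zero_iff.2 (by rw [Real.norm_eq_abs]; exact hc i)
  obtain ⟨x, hx, hxle⟩ := (isCompact_closedBall (0 : ℝ) R).ultrafilter_le_nhds (𝔘.map c)
    (by rwa [Ultrafilter.coe_map])
  refine ⟨x, ?_, by rwa [Ultrafilter.coe_map] at hxle⟩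
  rw [mem_closedBall_zero_iff, Real.norm_eq_abs] at hx
  exact hx

/-- **Bounded nets in a real Hilbert space have weak limits along ultrafilters**: if `‖ξ i‖ ≤ R`
then along an ultrafilter `𝔘` there is `z`, `‖z‖ ≤ R`, with `⟪Φ, ξ i⟫ → ⟪Φ, z⟫` for every `Φ`
(the limit functional is bounded and linear; Riesz representation). [folklore] -/
theorem exists_weak_limit_ultrafilter_real {ι : Type*} (𝔘 : Ultrafilter ι) {ξ : ι → E} {R : ℝ}
    (hR : 0 ≤ R) (hξ : ∀ i, ‖ξ i‖ ≤ R) :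
    ∃ z : E, ‖z‖ ≤ R ∧ ∀ Φ : E, Tendsto (fun i => ⟪Φ, ξ i⟫) (𝔘 : Filter ι) (𝓝 ⟪Φ, z⟫) := by
  have hlim : ∀ Φ : E, ∃ x : ℝ, |x| ≤ R * ‖Φ‖ ∧ Tendsto (fun i => ⟪Φ, ξ i⟫) (𝔘 : Filter ι) (𝓝 x) :=
    fun Φ => exists_tendsto_ultrafilter_of_abs_le 𝔘 fun i =>
      (abs_real_inner_le_norm Φ (ξ i)).trans (by rw [mul_comm]; exact mul_le_mul_of_nonneg_right (hξ i) (norm_nonneg Φ))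
  choose ℓ hℓb hℓ using hlim
  have hadd : ∀ Φ Φ' : E, ℓ (Φ + Φ') = ℓ Φ + ℓ Φ' := fun Φ Φ' =>
    tendsto_nhds_unique (hℓ (Φ + Φ')) (by simpa only [inner_add_left] using (hℓ Φ).add (hℓ Φ'))
  have hsmul : ∀ (c : ℝ) (Φ : E), ℓ (c • Φ) = c * ℓ Φ := fun c Φ =>
    tendsto_nhds_unique (hℓ (c • Φ)) (by simpa only [real_inner_smul_left] using (hℓ Φ).const_mul c)
  let L₀ : E →ₗ[ℝ] ℝ :=
    { toFun := ℓ
      map_add' := hadd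
      map_smul' := fun c Φ => by simp only [hsmul, RingHom.id_apply, smul_eq_mul] }
  let L : E →L[ℝ] ℝ := L₀.mkContinuous R fun Φ => by
    simp only [L₀, LinearMap.coe_mk, AddHom.coe_mk, Real.norm_eq_abs]
    exact hℓb Φ
  set z : E := (InnerProductSpace.toDual ℝ E).symm L with hz
  have hzΦ : ∀ Φ : E, ⟪Φ, z⟫ = ℓ Φ := by
    intro Φ
    rw [real_inner_comm, hz, InnerProductSpace.toDual_symm_apply]
    rfl
  refine ⟨z, ?_, fun Φ => by rw [hzΦ]; exact hℓ Φ⟩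
  have h1 : ‖z‖ ^ 2 ≤ R * ‖z‖ := by
    rw [← real_inner_self_eq_norm_sq, hzΦ]
    exact (le_abs_self _).trans (hℓb z)
  by_cases h0 : ‖z‖ = 0
  · rw [h0]; exact hR
  · exact le_of_mul_le_mul_right (by rw [← sq]; exact h1) ((norm_nonneg z).lt_of_ne (Ne.symm h0))

end WeakLimit

/-! ### The operators `S u = e^{−q/2} u` and `T(u, G) = e^{−q/2}(G − u b)` -/

section Operators

variable {lam : ℝ} (hlam : lam ∈ Set.Ico (0 : ℝ) 1)
include hlam

/-- `√ρ_λ ‖b_λ‖ ≤ 2/√(1−λ)`. [folklore] -/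
theorem sqrt_expNegQuadLam_mul_norm_driftLam_le (x : EuclideanSpace ℝ (Fin 2)) :
    Real.sqrt (Real.exp (-((1 + lam) / 4 * x 0 ^ 2 + (1 - lam) / 4 * x 1 ^ 2))) *
        ‖(toLp 2 ![(1 + lam) / 2 * x 0, (1 - lam) / 2 * x 1] : EuclideanSpace ℝ (Fin 2))‖ ≤
      2 / Real.sqrt (1 - lam) := by
  have hq : 0 < 1 - lam := by linarith [hlam.2]
  have h := expNegQuadLam_mul_norm_driftLam_sq_le hlam x
  have hρ0 : 0 ≤ Real.exp (-((1 + lam) / 4 * x 0 ^ 2 + (1 - lam) / 4 * x 1 ^ 2)) := (Real.exp_pos _).le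
  have hsq : (Real.sqrt (Real.exp (-((1 + lam) / 4 * x 0 ^ 2 + (1 - lam) / 4 * x 1 ^ 2))) *
      ‖(toLp 2 ![(1 + lam) / 2 * x 0, (1 - lam) / 2 * x 1] : EuclideanSpace ℝ (Fin 2))‖) ^ 2 ≤
      (2 / Real.sqrt (1 - lam)) ^ 2 := by
    rw [mul_pow, Real.sq_sqrt hρ0, div_pow, Real.sq_sqrt hq.le]
    calc _ ≤ 4 / (1 - lam) := h
      _ = 2 ^ 2 / (1 - lam) := by norm_num
  exact (pow_le_pow_iff_left₀ (by positivity) (by positivity) two_ne_zero).1 hsq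

/-- **`S : u ↦ e^{−q_λ/2} u`** as a bounded operator on `L²(μ_λ)` (norm `≤ 1`); `‖S u‖ = ‖ρ_λ u‖_{L²(dx)}`.
[folklore] -/
def sqrtWeightMulL : Lp ℝ 2 (gaussLamMeasure lam) →L[ℝ] Lp ℝ 2 (gaussLamMeasure lam) :=
  LinearMap.mkContinuous
    { toFun := fun u => MemLp.toLp (fun x : EuclideanSpace ℝ (Fin 2) =>
        Real.sqrt (Real.exp (-((1 + lam) / 4 * x 0 ^ 2 + (1 - lam) / 4 * x 1 ^ 2))) *
          (u : EuclideanSpace ℝ (Fin 2) → ℝ) x) (memLp_sqrtWeight_mul hlam u)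
      map_add' := fun u u' => by
        refine Lp.ext ?_
        filter_upwards [MemLp.coeFn_toLp (memLp_sqrtWeight_mul hlam (u + u')),
          Lp.coeFn_add ((memLp_sqrtWeight_mul hlam u).toLp _) ((memLp_sqrtWeight_mul hlam u').toLp _),
          MemLp.coeFn_toLp (memLp_sqrtWeight_mul hlam u), MemLp.coeFn_toLp (memLp_sqrtWeight_mul hlam u'),
          Lp.coeFn_add u u'] with x h1 h2 h3 h4 h5
        rw [h1, h2, Pi.add_apply, h3, h4, h5, Pi.add_apply, mul_add]
      map_smul' := fun c u => by
        refine Lp.ext ?_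
        filter_upwards [MemLp.coeFn_toLp (memLp_sqrtWeight_mul hlam (c • u)),
          Lp.coeFn_smul c ((memLp_sqrtWeight_mul hlam u).toLp _),
          MemLp.coeFn_toLp (memLp_sqrtWeight_mul hlam u), Lp.coeFn_smul c u] with x h1 h2 h3 h4
        rw [h1, RingHom.id_apply, h2, Pi.smul_apply, h3, h4, Pi.smul_apply, smul_eq_mul, smul_eq_mul]
        ring }
    1 fun u => by
      refine Lp.norm_le_mul_norm_of_ae_le_mul ?_
      filter_upwards [MemLp.coeFn_toLp (memLp_sqrtWeight_mul hlam u)] with x hx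
      simp only [LinearMap.coe_mk, AddHom.coe_mk]
      rw [hx, norm_mul, one_mul, Real.norm_of_nonneg (Real.sqrt_nonneg _)]
      refine mul_le_of_le_one_left (norm_nonneg _) ?_
      rw [Real.sqrt_le_one]
      exact expNegQuadLam_le_one hlam x

/-- A.e. formula for `S u`. [folklore] -/
theorem sqrtWeightMulL_ae (u : Lp ℝ 2 (gaussLamMeasure lam)) :
    ((sqrtWeightMulL hlam u : Lp ℝ 2 (gaussLamMeasure lam)) : EuclideanSpace ℝ (Fin 2) → ℝ) =ᵐ[gaussLamMeasure lam]
      fun x => Real.sqrt (Real.exp (-((1 + lam) / 4 * x 0 ^ 2 + (1 - lam) / 4 * x 1 ^ 2))) *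
        (u : EuclideanSpace ℝ (Fin 2) → ℝ) x := by
  have h : sqrtWeightMulL hlam u = MemLp.toLp _ (memLp_sqrtWeight_mul hlam u) := rfl
  rw [h]; exact MemLp.coeFn_toLp _

/-- **`‖S u‖² = ⟪u, (ρU)₁⟫ = ‖ρ_λ u‖²_{L²(dx)}`**. [folklore] -/
theorem norm_sqrtWeightMulL_sq (u : Lp ℝ 2 (gaussLamMeasure lam)) :
    ‖sqrtWeightMulL hlam u‖ ^ 2 = ⟪u, (memLp_weight_mul_fst hlam u).toLp _⟫ := by
  rw [inner_fst_weightMul_fst_eq hlam, norm_sq_Lp_two_eq_integral_norm_sq]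
  refine integral_congr_ae ?_
  filter_upwards [sqrtWeightMulL_ae hlam u] with x hx
  rw [hx, norm_mul, Real.norm_of_nonneg (Real.sqrt_nonneg _), mul_pow, Real.sq_sqrt (Real.exp_pos _).le,
    Real.norm_eq_abs, sq_abs]

/-- The flat-gradient integrand `e^{−q/2} G − u (e^{−q/2} b)` lies in `L²(μ_λ; ℝ²)`. [folklore] -/
theorem memLp_flatGrad (U : WithLp 2 (Lp ℝ 2 (gaussLamMeasure lam) × Lp (EuclideanSpace ℝ (Fin 2)) 2 (gaussLamMeasure lam))) :
    MemLp (fun x : EuclideanSpace ℝ (Fin 2) =>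
      Real.sqrt (Real.exp (-((1 + lam) / 4 * x 0 ^ 2 + (1 - lam) / 4 * x 1 ^ 2))) •
          (U.snd : EuclideanSpace ℝ (Fin 2) → EuclideanSpace ℝ (Fin 2)) x -
        (U.fst : EuclideanSpace ℝ (Fin 2) → ℝ) x •
          (Real.sqrt (Real.exp (-((1 + lam) / 4 * x 0 ^ 2 + (1 - lam) / 4 * x 1 ^ 2))) •
            (toLp 2 ![(1 + lam) / 2 * x 0, (1 - lam) / 2 * x 1] : EuclideanSpace ℝ (Fin 2))))
      2 (gaussLamMeasure lam) := by
  have hc : Continuous fun x : EuclideanSpace ℝ (Fin 2) =>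
      Real.sqrt (Real.exp (-((1 + lam) / 4 * x 0 ^ 2 + (1 - lam) / 4 * x 1 ^ 2))) := (continuous_expNegQuadLam lam).sqrt
  refine MemLp.sub ?_ ?_
  · refine MemLp.of_le_mul (c := 1) (Lp.memLp U.snd) (hc.aestronglyMeasurable.smul (Lp.aestronglyMeasurable U.snd))
      (Eventually.of_forall fun x => ?_)
    rw [norm_smul, one_mul, Real.norm_of_nonneg (Real.sqrt_nonneg _)]
    refine mul_le_of_le_one_left (norm_nonneg _) ?_
    rw [Real.sqrt_le_one]; exact expNegQuadLam_le_one hlam x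
  · refine MemLp.of_le_mul (c := 2 / Real.sqrt (1 - lam)) (Lp.memLp U.fst)
      ((Lp.aestronglyMeasurable U.fst).smul ((hc.smul (continuous_driftLam_field (lam := lam))).aestronglyMeasurable))
      (Eventually.of_forall fun x => ?_)
    rw [norm_smul, norm_smul, Real.norm_of_nonneg (Real.sqrt_nonneg _), mul_comm]
    exact mul_le_mul_of_nonneg_right (sqrt_expNegQuadLam_mul_norm_driftLam_le hlam x) (norm_nonneg _)

/-- **`T : (u, G) ↦ e^{−q_λ/2}(G − u b_λ)`** as a bounded operator `L²(μ_λ) × L²(μ_λ;ℝ²) → L²(μ_λ;ℝ²)`;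
`‖T U‖ = ‖∇(ρ_λ u)‖_{L²(dx)}` when `G` is the weak gradient of `u`. [folklore] -/
def flatGradL : WithLp 2 (Lp ℝ 2 (gaussLamMeasure lam) × Lp (EuclideanSpace ℝ (Fin 2)) 2 (gaussLamMeasure lam)) →L[ℝ]
    Lp (EuclideanSpace ℝ (Fin 2)) 2 (gaussLamMeasure lam) :=
  LinearMap.mkContinuous
    { toFun := fun U => MemLp.toLp _ (memLp_flatGrad hlam U)
      map_add' := fun U U' => by
        refine Lp.ext ?_
        filter_upwards [MemLp.coeFn_toLp (memLp_flatGrad hlam (U + U')),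
          Lp.coeFn_add ((memLp_flatGrad hlam U).toLp _) ((memLp_flatGrad hlam U').toLp _),
          MemLp.coeFn_toLp (memLp_flatGrad hlam U), MemLp.coeFn_toLp (memLp_flatGrad hlam U'),
          Lp.coeFn_add U.fst U'.fst, Lp.coeFn_add U.snd U'.snd] with x h1 h2 h3 h4 h5 h6
        rw [h1, h2, Pi.add_apply, h3, h4, WithLp.add_fst, WithLp.add_snd, h5, h6, Pi.add_apply, Pi.add_apply,
          smul_add, add_smul]
        abel
      map_smul' := fun c U => by
        refine Lp.ext ?_
        filter_upwards [MemLp.coeFn_toLp (memLp_flatGrad hlam (c • U)),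
          Lp.coeFn_smul c ((memLp_flatGrad hlam U).toLp _),
          MemLp.coeFn_toLp (memLp_flatGrad hlam U), Lp.coeFn_smul c U.fst, Lp.coeFn_smul c U.snd]
          with x h1 h2 h3 h4 h5
        rw [h1, RingHom.id_apply, h2, Pi.smul_apply, h3, WithLp.smul_fst, WithLp.smul_snd, h4, h5,
          Pi.smul_apply, Pi.smul_apply, smul_sub, smul_comm c, smul_eq_mul, mul_smul] }
    (1 + 2 / Real.sqrt (1 - lam)) fun U => by
      have hq : 0 < 1 - lam := by linarith [hlam.2]
      simp only [LinearMap.coe_mk, AddHom.coe_mk]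
      -- split `T U = P − Q`
      have hP : MemLp (fun x : EuclideanSpace ℝ (Fin 2) =>
          Real.sqrt (Real.exp (-((1 + lam) / 4 * x 0 ^ 2 + (1 - lam) / 4 * x 1 ^ 2))) •
            (U.snd : EuclideanSpace ℝ (Fin 2) → EuclideanSpace ℝ (Fin 2)) x) 2 (gaussLamMeasure lam) :=
        MemLp.of_le_mul (c := 1) (Lp.memLp U.snd) (((continuous_expNegQuadLam lam).sqrt).aestronglyMeasurable.smul
          (Lp.aestronglyMeasurable U.snd)) (Eventually.of_forall fun x => by
            rw [norm_smul, one_mul, Real.norm_of_nonneg (Real.sqrt_nonneg _)]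
            refine mul_le_of_le_one_left (norm_nonneg _) ?_
            rw [Real.sqrt_le_one]; exact expNegQuadLam_le_one hlam x)
      have hQ : MemLp (fun x : EuclideanSpace ℝ (Fin 2) => (U.fst : EuclideanSpace ℝ (Fin 2) → ℝ) x •
          (Real.sqrt (Real.exp (-((1 + lam) / 4 * x 0 ^ 2 + (1 - lam) / 4 * x 1 ^ 2))) •
            (toLp 2 ![(1 + lam) / 2 * x 0, (1 - lam) / 2 * x 1] : EuclideanSpace ℝ (Fin 2)))) 2 (gaussLamMeasure lam) :=
        MemLp.of_le_mul (c := 2 / Real.sqrt (1 - lam)) (Lp.memLp U.fst)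
          ((Lp.aestronglyMeasurable U.fst).smul ((((continuous_expNegQuadLam lam).sqrt).smul
            (continuous_driftLam_field (lam := lam))).aestronglyMeasurable)) (Eventually.of_forall fun x => by
            rw [norm_smul, norm_smul, Real.norm_of_nonneg (Real.sqrt_nonneg _), mul_comm]
            exact mul_le_mul_of_nonneg_right (sqrt_expNegQuadLam_mul_norm_driftLam_le hlam x) (norm_nonneg _))
      have hsplit : (memLp_flatGrad hlam U).toLp _ = hP.toLp _ - hQ.toLp _ := MemLp.toLp_sub hP hQ
      have h1 : ‖hP.toLp _‖ ≤ 1 * ‖U.snd‖ := by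
        refine Lp.norm_le_mul_norm_of_ae_le_mul ?_
        filter_upwards [MemLp.coeFn_toLp hP] with x hx
        rw [hx, norm_smul, one_mul, Real.norm_of_nonneg (Real.sqrt_nonneg _)]
        refine mul_le_of_le_one_left (norm_nonneg _) ?_
        rw [Real.sqrt_le_one]; exact expNegQuadLam_le_one hlam x
      have h2 : ‖hQ.toLp _‖ ≤ 2 / Real.sqrt (1 - lam) * ‖U.fst‖ := by
        refine Lp.norm_le_mul_norm_of_ae_le_mul ?_
        filter_upwards [MemLp.coeFn_toLp hQ] with x hx
        rw [hx, norm_smul, norm_smul, Real.norm_of_nonneg (Real.sqrt_nonneg _), mul_comm]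
        exact mul_le_mul_of_nonneg_right (sqrt_expNegQuadLam_mul_norm_driftLam_le hlam x) (norm_nonneg _)
      have hfst : ‖U.fst‖ ≤ ‖U‖ := (norm_fst_le_and_norm_snd_le U).1
      have hsnd : ‖U.snd‖ ≤ ‖U‖ := (norm_fst_le_and_norm_snd_le U).2
      rw [hsplit]
      calc ‖hP.toLp _ - hQ.toLp _‖ ≤ ‖hP.toLp _‖ + ‖hQ.toLp _‖ := norm_sub_le _ _
        _ ≤ 1 * ‖U‖ + 2 / Real.sqrt (1 - lam) * ‖U‖ := add_le_add (h1.trans (by rw [one_mul, one_mul]; exact hsnd))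
            (h2.trans (mul_le_mul_of_nonneg_left hfst (by positivity)))
        _ = (1 + 2 / Real.sqrt (1 - lam)) * ‖U‖ := by ring

/-- A.e. formula for `T U`. [folklore] -/
theorem flatGradL_ae (U : WithLp 2 (Lp ℝ 2 (gaussLamMeasure lam) × Lp (EuclideanSpace ℝ (Fin 2)) 2 (gaussLamMeasure lam))) :
    ((flatGradL hlam U : Lp (EuclideanSpace ℝ (Fin 2)) 2 (gaussLamMeasure lam)) :
        EuclideanSpace ℝ (Fin 2) → EuclideanSpace ℝ (Fin 2)) =ᵐ[gaussLamMeasure lam]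
      fun x => Real.sqrt (Real.exp (-((1 + lam) / 4 * x 0 ^ 2 + (1 - lam) / 4 * x 1 ^ 2))) •
          (U.snd : EuclideanSpace ℝ (Fin 2) → EuclideanSpace ℝ (Fin 2)) x -
        (U.fst : EuclideanSpace ℝ (Fin 2) → ℝ) x •
          (Real.sqrt (Real.exp (-((1 + lam) / 4 * x 0 ^ 2 + (1 - lam) / 4 * x 1 ^ 2))) •
            (toLp 2 ![(1 + lam) / 2 * x 0, (1 - lam) / 2 * x 1] : EuclideanSpace ℝ (Fin 2))) := by
  have h : flatGradL hlam U = MemLp.toLp _ (memLp_flatGrad hlam U) := rfl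
  rw [h]; exact MemLp.coeFn_toLp _

/-- **`‖T U‖² = ∫ ρ ‖G − u b‖² dμ_λ`** (`= ‖∇(ρu)‖²_{L²(dx)}` on `H`). [folklore] -/
theorem norm_flatGradL_sq (U : WithLp 2 (Lp ℝ 2 (gaussLamMeasure lam) × Lp (EuclideanSpace ℝ (Fin 2)) 2 (gaussLamMeasure lam))) :
    ‖flatGradL hlam U‖ ^ 2 =
      ∫ x, Real.exp (-((1 + lam) / 4 * x 0 ^ 2 + (1 - lam) / 4 * x 1 ^ 2)) *
          ‖(U.snd : EuclideanSpace ℝ (Fin 2) → EuclideanSpace ℝ (Fin 2)) x -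
            (U.fst : EuclideanSpace ℝ (Fin 2) → ℝ) x •
              (toLp 2 ![(1 + lam) / 2 * x 0, (1 - lam) / 2 * x 1] : EuclideanSpace ℝ (Fin 2))‖ ^ 2
          ∂gaussLamMeasure lam := by
  rw [norm_sq_Lp_two_eq_integral_norm_sq]
  refine integral_congr_ae ?_
  filter_upwards [flatGradL_ae hlam U] with x hx
  rw [hx, smul_comm ((U.fst : EuclideanSpace ℝ (Fin 2) → ℝ) x), ← smul_sub, norm_smul,
    Real.norm_of_nonneg (Real.sqrt_nonneg _), mul_pow, Real.sq_sqrt (Real.exp_pos _).le]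

end Operators

/-! ### Closedness of the constraint sets -/

section Closed

variable {lam : ℝ} (hlam : lam ∈ Set.Ico (0 : ℝ) 1)
include hlam

omit hlam in
/-- The cone of a.e. non-negative elements of `L²(μ_λ)` is closed (norm limits have a.e. convergent
subsequences). [folklore] -/
theorem isClosed_nonneg_Lp :
    IsClosed {u : Lp ℝ 2 (gaussLamMeasure lam) | 0 ≤ᵐ[gaussLamMeasure lam] (u : EuclideanSpace ℝ (Fin 2) → ℝ)} := by
  refine (isSeqClosed_iff_isClosed.1 fun v u hv hlim => ?_)
  obtain ⟨ns, -, hae⟩ := exists_subseq_tendsto_ae_of_tendsto_Lp hlim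
  filter_upwards [hae, ae_all_iff.2 fun k => hv (ns k)] with x hx hx'
  exact ge_of_tendsto' hx fun k => hx' k

/-- **Closedness of the constraint sets** of the Schauder argument: for a norm-closed
`P ⊆ L²(μ_λ)` and `R₁, R_H`, the set of first components `u` of pairs `U ∈ H¹(μ_λ)` with `P u`,
`‖T U‖ ≤ R₁` and `‖U‖ ≤ R_H` is closed in `L²(μ_λ)` (weak limits of the bounded witnesses along an
ultrafilter: `H` is weakly closed, `‖T ·‖` and `‖·‖` are weakly lower semicontinuous via the
adjoint). [folklore] -/
theorem isClosed_fst_image_constraints {P : Set (Lp ℝ 2 (gaussLamMeasure lam))} (hP : IsClosed P) (R₁ RH : ℝ) :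
    IsClosed {u : Lp ℝ 2 (gaussLamMeasure lam) | ∃ U ∈ gaussLamFormDomain lam,
      U.fst = u ∧ u ∈ P ∧ ‖flatGradL hlam U‖ ≤ R₁ ∧ ‖U‖ ≤ RH} := by
  refine (isSeqClosed_iff_isClosed.1 fun v u hv hlim => ?_)
  choose U hUH hUfst hUP hUT hUR using hv
  have hRH : 0 ≤ RH := (norm_nonneg _).trans (hUR 0)
  have hR₁ : 0 ≤ R₁ := (norm_nonneg _).trans (hUT 0)
  -- weak limit along a free ultrafilter
  set 𝔘 : Ultrafilter ℕ := Filter.hyperfilter ℕ with h𝔘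
  have h𝔘le : (𝔘 : Filter ℕ) ≤ atTop := by
    rw [← Nat.cofinite_eq_atTop]; exact Filter.hyperfilter_le_cofinite
  obtain ⟨z, hz, hzw⟩ := exists_weak_limit_ultrafilter_real 𝔘 hRH hUR
  -- `z ∈ H` (closed subspaces are weakly closed)
  have hzH : z ∈ gaussLamFormDomain lam := by
    rw [← Submodule.orthogonal_orthogonal (gaussLamFormDomain lam), Submodule.mem_orthogonal]
    intro w hw
    have h0 : ∀ n, ⟪w, U n⟫ = 0 := fun n => by
      rw [real_inner_comm]; exact (Submodule.mem_orthogonal _ _).1 hw _ (hUH n)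
    have h1 := hzw w
    simp_rw [h0] at h1
    exact tendsto_nhds_unique h1 tendsto_const_nhds
  -- `z.fst = u`
  have hzu : z.fst = u := by
    refine ext_inner_left ℝ fun φ => ?_
    have h1 : ∀ V : WithLp 2 (Lp ℝ 2 (gaussLamMeasure lam) × Lp (EuclideanSpace ℝ (Fin 2)) 2 (gaussLamMeasure lam)),
        ⟪(toLp 2 (φ, 0) : WithLp 2 (Lp ℝ 2 (gaussLamMeasure lam) × Lp (EuclideanSpace ℝ (Fin 2)) 2 (gaussLamMeasure lam))), V⟫ =
          ⟪φ, V.fst⟫ := fun V => by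
      rw [WithLp.prod_inner_apply]; simp
    have hlimφ : Tendsto (fun n => ⟪φ, (U n).fst⟫) (𝔘 : Filter ℕ) (𝓝 ⟪φ, z.fst⟫) := by
      have := hzw (toLp 2 (φ, 0)); simp_rw [h1] at this; exact this
    have hlim2 : Tendsto (fun n => ⟪φ, (U n).fst⟫) (𝔘 : Filter ℕ) (𝓝 ⟪φ, u⟫) := by
      have hc : Continuous fun y : Lp ℝ 2 (gaussLamMeasure lam) => ⟪φ, y⟫ := continuous_const.inner continuous_id
      have h := (hc.tendsto u).comp hlim
      simp_rw [hUfst]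
      exact h.mono_left h𝔘le
    exact tendsto_nhds_unique hlimφ hlim2
  -- `u ∈ P`
  have huP : u ∈ P := hP.mem_of_tendsto hlim (Eventually.of_forall hUP)
  -- `‖T z‖ ≤ R₁` via the adjoint
  have hTz : ‖flatGradL hlam z‖ ≤ R₁ := by
    set T := flatGradL hlam with hT
    have hlimT : Tendsto (fun n => ⟪T z, T (U n)⟫) (𝔘 : Filter ℕ) (𝓝 ⟪T z, T z⟫) := by
      have h := hzw (ContinuousLinearMap.adjoint T (T z))
      simp_rw [ContinuousLinearMap.adjoint_inner_left] at h
      exact h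
    have hbd : ∀ n, ⟪T z, T (U n)⟫ ≤ ‖T z‖ * R₁ := fun n =>
      (real_inner_le_norm _ _).trans (mul_le_mul_of_nonneg_left (hUT n) (norm_nonneg _))
    have hle : ⟪T z, T z⟫ ≤ ‖T z‖ * R₁ := le_of_tendsto' hlimT hbd
    rw [real_inner_self_eq_norm_sq] at hle
    by_cases h0 : ‖T z‖ = 0
    · rw [h0]; exact hR₁
    · exact le_of_mul_le_mul_left (by rw [← sq]; linarith) ((norm_nonneg _).lt_of_ne (Ne.symm h0))
  exact ⟨z, hzH, hzu, huP, hTz, hz⟩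

end Closed

end Literature.Analysis.FluidPDE
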